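import Summits.Ventures.MM22.Rank333.ProfileCertStore0
import Summits.Ventures.MM22.Rank333.ProfileCertStore1
import Summits.Ventures.MM22.Rank333.ProfileCertStore2
import Summits.Ventures.MM22.Rank333.ProfileCertStore3
import Summits.Ventures.MM22.Rank333.ProfileCertStore4
import Summits.Ventures.MM22.Rank333.ProfileCertStore5
import Summits.Ventures.MM22.Rank333.ProfileCertStore6
import Summits.Ventures.MM22.Rank333.ProfileCertStore7
import Summits.Ventures.MM22.Rank333.ProfileCertStore8
import Summits.Ventures.MM22.Rank333.ProfileCertStore9
import Summits.Ventures.MM22.Rank333.ProfileCertStore10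
import Summits.Ventures.MM22.Rank333.ProfileCertStore11
import Summits.Ventures.MM22.Rank333.ProfileCertStore12
import Summits.Ventures.MM22.Rank333.ProfileCertStore13
import Summits.Ventures.MM22.Rank333.ProfileCertStore14
import Summits.Ventures.MM22.Rank333.ProfileCertStore15
import HarnessLib

/-!
# MM22 venture — PROFILE-CERT kernel replay DATA: shared row store (composition of the 16 parts)

HONEST FRAMING (cell `pub-mm22`, seat p1 g5; V4-MENU item (0′)). Generated by `pc2tree.py` from the whole-root
certificate `root_wang8_minrules_v1.pcert` (sha256 6c9c87c0…, p2 g3/g4; VALID under two import-disjoint conventional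
checkers) — the 4-level composition by the low bits of the global row id. Every theorem here is a `decide +kernel` (or `rfl`) about the checker of `ProfileCertKernel`; its
MEANING is supplied by `ProfileCertGlue` and the assembly files. Nothing here is a bound on `R_𝔽₂(⟨3,3,3⟩)`; no summit claim.
-/

set_option autoImplicit false
set_option maxRecDepth 200000
set_option maxHeartbeats 0

namespace Summit.Ventures.MM22.ProfileCert

open Summit.MatrixMultiplication.OmegaCensus.GF2RankLB

/-- The shared row store of the whole certificate (10304 rows): `pcRT.get i = pcStore(i % 16).get (i / 16)`. -/
def pcRT : RT := (RT.node (RT.node (RT.node (RT.node pcStore0 pcStore8) (RT.node pcStore4 pcStore12)) (RT.node (RT.node pcStore2 pcStore10) (RT.node pcStore6 pcStore14))) (RT.node (RT.node (RT.node pcStore1 pcStore9) (RT.node pcStore5 pcStore13)) (RT.node (RT.node pcStore3 pcStore11) (RT.node pcStore7 pcStore15))))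

end Summit.Ventures.MM22.ProfileCert
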